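import Mathlib
import HarnessLib
import Summits.ValiantsHypothesis.ValiantsHypothesis.Theses.MonotoneRestoration
import Literature.Computability.AlgebraicComplexity.ArithCircuit
import Literature.Computability.AlgebraicComplexity.ArithCircuitProofs
import Literature.Computability.AlgebraicComplexity.MonotoneStructure
import Literature.Computability.AlgebraicComplexity.PermanentIrreducible
import Literature.ModelTheory.FiniteModelTheory.CkEquiv
import Summits.ValiantsHypothesis.ValiantsHypothesis.Theorems.MonotoneRestorationMonotoneRestorationQPCosetCount
import Summits.ValiantsHypothesis.ValiantsHypothesis.Theorems.MonotoneRestorationMonotoneRestorationQPSymmetricLB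
import Summits.ValiantsHypothesis.ValiantsHypothesis.Theorems.MonotoneRestorationMonotoneRestorationQPSupportSymmetrisation
import Summits.ValiantsHypothesis.ValiantsHypothesis.Theorems.MonotoneRestorationMonotoneRestorationQPSparseRegime
import Summits.ValiantsHypothesis.ValiantsHypothesis.Theorems.MonotoneRestorationMonotoneRestorationQPBeta
import Literature.Computability.AlgebraicComplexity.SymmetricArithCircuit
import Literature.Computability.AlgebraicComplexity.DawarWilsenach2025Proofs
import Literature.GroupTheory.PermutationGroups.SmallIndexSubgroups
import Summits.ValiantsHypothesis.ValiantsHypothesis.Theorems.MonotoneRestorationQP.Negative.LoadBearing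
import Summits.ValiantsHypothesis.ValiantsHypothesis.Theorems.MonotoneRestorationMonotoneRestorationQPPermSupportCount

/-! TTRL-lite variant V19304 of stmt-ValiantsHypothesis-15886 -/

namespace Summit.ValiantsHypothesis.ValiantsHypothesis.Theorems

open Summit.ValiantsHypothesis.ValiantsHypothesis.Theses.MonotoneRestoration
open Literature.Computability.AlgebraicComplexity

/-- TTRL-lite variant V19304 (`[G1]` shifted growth step) of the registered stub
`stub_gammaArithmetic` of `stmt-ValiantsHypothesis-15886`: for every shift `c` and exponent `d`,
eventually (in `m`) `(m + c) ^ d ≤ 2 ^ m`.  Proof: Mathlib's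
`isLittleO_pow_const_const_pow_of_one_lt` over `ℝ` gives `t ^ d = o(2 ^ t)`; taking the little-o
constant `(2 ^ c)⁻¹` and `t = m + c` yields `(m + c) ^ d ≤ (2 ^ c)⁻¹ · 2 ^ (m + c) = 2 ^ m` for all
`m + c ≥ M`, hence for all `m ≥ M`; cast back to `ℕ`. -/
theorem stub_gammaArithmetic_var19304 :
    ∀ (c d : ℕ), ∃ M : ℕ, ∀ m : ℕ, M ≤ m → (m + c) ^ d ≤ 2 ^ m := by
  intro c d
  have h := isLittleO_pow_const_const_pow_of_one_lt (R := ℝ) d (one_lt_two : (1 : ℝ) < 2)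
  have hc : (0 : ℝ) < ((2 : ℝ) ^ c)⁻¹ := by positivity
  have h1 := h.def hc
  rw [Filter.eventually_atTop] at h1
  obtain ⟨M, hM⟩ := h1
  refine ⟨M, fun m hm => ?_⟩
  have h2 := hM (m + c) (by omega)
  rw [Real.norm_of_nonneg (by positivity), Real.norm_of_nonneg (by positivity)] at h2
  have h3 : ((m + c : ℕ) : ℝ) ^ d ≤ (2 : ℝ) ^ m := by
    calc ((m + c : ℕ) : ℝ) ^ d ≤ ((2 : ℝ) ^ c)⁻¹ * (2 : ℝ) ^ (m + c) := h2
      _ = (2 : ℝ) ^ m := by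
        rw [pow_add, mul_comm ((2 : ℝ) ^ m) _, ← mul_assoc,
          inv_mul_cancel₀ (by positivity : (2 : ℝ) ^ c ≠ 0), one_mul]
  exact_mod_cast h3

end Summit.ValiantsHypothesis.ValiantsHypothesis.Theorems
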